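import Literature.MathematicalPhysics.KineticTheory.CollisionTubeGeometry
import Literature.MathematicalPhysics.KineticTheory.CollisionTubePullbackPacking
import Literature.MathematicalPhysics.KineticTheory.HardSphereUniformGasShift
import Literature.MathematicalPhysics.KineticTheory.HardSphereUniformDensityLLN
import HarnessLib

/-!
# The collision-tube functional at rung 0: the double-sum form and the density-weight replacement

Topic `Literature/MathematicalPhysics/KineticTheory` (kind proof; static input of the TUBE side of the
Enskog closure at rung 0, crux line `even-rung-mean-variance` of `JParityClosure.EvenStressEnskog`,
stmt-AtomisticToContinuum-13079).

* `tubeStat_one_eq_sum_tubeMark` — at truncation level `1` the tube functional of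
  `CollisionTubeFunctional` is `((N+1)κ)⁻¹ Σ_{i ≠ j} χ(t,xᵢ) g(σ³ ρ̃_r(x, xᵢ)) · tubeMark κ Ξ (ε⁻¹ sepVec xᵢ xⱼ) vᵢ vⱼ`
  for marks vanishing at grazing normals (`tubeTerm` of `CollisionTubePullbackDefs`, the scaling lemmas
  of `CollisionTubeGeometry`, `mollDensity = empDensity`).
* `abs_tubeMark_le_shellInd`, `sum_abs_tubeMark_le` — a nonzero tube mark of the truncated even mark
  `Ξ_L` forces the pair into the near-contact shell `ε < ‖q‖ ≤ ε(1 + 2Lκ)`; by hard-sphere packing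
  (`shellCount_le`) each particle has at most `125` shell partners, so `Σⱼ |tubeMark_{ij}| ≤ 2L · 125`
  on the hard-sphere domain (`2Lκ ≤ 1`).
* `integral_sum_densityWeight_tubeMark_le` — replacing the density weight `g(σ³ρ̃_r(x,xᵢ))` by `g(σ³)`
  costs, in rung-0 Gibbs mean, at most `2L · 125 · (N+1) · C_χ · (ζ' + 2 C_g · P_N(Bad))`, `Bad` the
  (measurable) event that the `L²(𝕋³)` deviation of `ρ̃_r − 1` exceeds the threshold of
  `HardSphereUniformDensityLLN`; `exists_posGibbs_sqDev_le` — `P_N(Bad) → 0`.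

References: C. Cercignani, R. Illner, M. Pulvirenti (1994) §2.2 [CIPDiluteGases1994]; H. Spohn (1991)
Part I §2.3 [Spohn1991].
-/

noncomputable section

namespace Literature.MathematicalPhysics.KineticTheory

open _root_.MeasureTheory _root_.ProbabilityTheory Set Filter _root_.Topology Function
open scoped ENNReal BigOperators InnerProductSpace
open Literature.Analysis.FluidPDE

/-! ## The tube functional at level `1` as a double sum of tube marks -/

/-- The truncated even mark vanishes at normals orthogonal to the relative velocity (grazing), so its
weak-tube and strict-tube marks agree (`0 ≤ L`). [folklore] -/
theorem evenMarkTrunc_eq_zero_of_inner_eq_zero (k l : Fin 3) {L : ℝ} (hL : 0 ≤ L) (n v v' : V3)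
    (h : ⟪n, v - v'⟫_ℝ = 0) : evenMarkTrunc k l L (n, v, v') = 0 := by
  unfold evenMarkTrunc
  have h' : ⟪v' - v, n⟫_ℝ = 0 := by
    rw [real_inner_comm, ← neg_sub, inner_neg_right, h, neg_zero]
  dsimp only
  rw [h', max_self, min_eq_left (by linarith), zero_mul, zero_mul]

/-- The mollified density of a configuration is the empirical density of its positions. [folklore] -/
theorem mollDensity_eq_empDensity {N : ℕ} (r : ℝ) (z : Config (N + 1) (Fin 3) T3) (y : T3) :
    mollDensity r z y = empDensity r (fun m => (z m).1) y := by
  unfold mollDensity empDensity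
  rw [integral_empiricalMeasure]

/-- **One tube term is the density weight times the tube mark** (diameter `ε > 0`, mark vanishing at
grazing normals): the predicate and predicted normal of `tubeStat` are those of `ε⁻¹ sepVec` at unit
scale (`tubePred_iff_smul_mem_weakTube`, `impactNormal_scale`, `ite_weakTube_eq_tubeMark`). [folklore] -/
theorem tubeTerm_eq_weight_mul_tubeMark {σ : ℝ} {N : ℕ} (hε : 0 < hsDiameter σ N)
    (χ : ℝ × UnitAddTorus (Fin 3) → ℝ) (g : ℝ → ℝ) {Ξ : V3 × V3 × V3 → ℝ}
    (hΞ : ∀ n v v' : V3, ⟪n, v - v'⟫_ℝ = 0 → Ξ (n, v, v') = 0) (r κ t : ℝ)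
    (z : Config (N + 1) (Fin 3) T3) (i j : Fin (N + 1)) :
    tubeTerm σ N χ g Ξ r κ t z i j =
      if i ≠ j then weightAt σ N χ g r t z i *
        tubeMark κ Ξ ((hsDiameter σ N)⁻¹ • Torus.reprSym ((z i).1 - (z j).1)) (z i).2 (z j).2 else 0 := by
  unfold tubeTerm
  by_cases hij : i ≠ j
  · rw [if_pos hij]
    have hq : sepAt z i j = Torus.reprSym ((z i).1 - (z j).1) := rfl
    have hw : relVel z i j = (z i).2 - (z j).2 := rfl
    rw [← ite_weakTube_eq_tubeMark hΞ, ← hq, ← hw]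
    by_cases hP : hsDiameter σ N < ‖sepAt z i j‖ ∧ ⟪sepAt z i j, relVel z i j⟫_ℝ < 0 ∧
        ‖relVel z i j‖ ^ 2 * (‖sepAt z i j‖ ^ 2 - hsDiameter σ N ^ 2) ≤ ⟪sepAt z i j, relVel z i j⟫_ℝ ^ 2 ∧
        hitTime (hsDiameter σ N) (sepAt z i j) (relVel z i j) ≤ κ * hsDiameter σ N
    · have hmem : (hsDiameter σ N)⁻¹ • sepAt z i j ∈ weakTube κ (relVel z i j) := by
        rw [← tubePred_iff_smul_mem_weakTube hε]
        exact hP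
      rw [if_pos ⟨hij, hP⟩, if_pos hmem, hitTime, impactNormal_scale hε]
    · have hmem : (hsDiameter σ N)⁻¹ • sepAt z i j ∉ weakTube κ (relVel z i j) := by
        rw [← tubePred_iff_smul_mem_weakTube hε]
        exact hP
      rw [if_neg (fun h => hP h.2), if_neg hmem, mul_zero]
  · rw [if_neg hij, if_neg (fun h => hij h.1)]

/-- **The tube functional at level `1` as a weighted double sum of tube marks**:
`tubeStat σ N χ g Ξ r ϑ 1 κ t z = ((N+1)κ)⁻¹ Σ_{i ≠ j} χ(t,xᵢ) g(σ³ ρ̃_r(x,xᵢ)) tubeMark κ Ξ (ε⁻¹ sepVec xᵢ xⱼ) vᵢ vⱼ`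
(`σ > 0`, mark vanishing at grazing normals). [folklore] -/
theorem tubeStat_one_eq_sum_tubeMark {σ : ℝ} (hσ : 0 < σ) (N : ℕ) (χ : ℝ × UnitAddTorus (Fin 3) → ℝ)
    (g : ℝ → ℝ) {Ξ : V3 × V3 × V3 → ℝ} (hΞ : ∀ n v v' : V3, ⟪n, v - v'⟫_ℝ = 0 → Ξ (n, v, v') = 0)
    (r ϑ κ t : ℝ) (z : Config (N + 1) (Fin 3) T3) :
    tubeStat σ N χ g Ξ r ϑ 1 κ t z = ((N + 1 : ℝ) * κ)⁻¹ * ∑ i, ∑ j,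
      if i ≠ j then χ (t, (z i).1) * g (σ ^ 3 * empDensity r (fun m => (z m).1) (z i).1) *
        tubeMark κ Ξ ((hsDiameter σ N)⁻¹ • Torus.reprSym ((z i).1 - (z j).1)) (z i).2 (z j).2 else 0 := by
  rw [tubeStat_one_eq]
  congr 1
  refine Finset.sum_congr rfl fun i _ => Finset.sum_congr rfl fun j _ => ?_
  rw [tubeTerm_eq_weight_mul_tubeMark (hsDiameter_pos hσ N) χ g hΞ r κ t z i j, weightAt,
    mollDensity_eq_empDensity]

/-! ## A nonzero tube mark of `Ξ_L` puts the pair into the near-contact shell -/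

/-- `Ξ_L = 0` at relative speed `≥ 2L` (`0 ≤ L`; the case `L = 0` by inspection). [folklore] -/
theorem evenMarkTrunc_eq_zero_of_two_mul_le' (k l : Fin 3) {L : ℝ} (hL : 0 ≤ L) {q : V3 × V3 × V3}
    (h : 2 * L ≤ ‖q.2.2 - q.2.1‖) : evenMarkTrunc k l L q = 0 := by
  rcases hL.eq_or_lt with h0 | hpos
  · subst h0
    rw [evenMarkTrunc, mul_zero, min_eq_right (le_max_right _ _), zero_mul, zero_mul]
  · exact evenMarkTrunc_eq_zero_of_le k l hpos h

/-- **A nonzero tube mark of the truncated even mark forces the pair into the near-contact shell**: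
`|tubeMark κ Ξ_L (ε⁻¹ sepVec xᵢ xⱼ) vᵢ vⱼ| ≤ 2L · shellInd` (`ε > 0`, `L, κ ≥ 0`: off the shell
`ε < ‖q‖ ≤ ε(1 + 2Lκ)` either the pair is not in the strict tube or its relative speed is `≥ 2L`, where
`Ξ_L` vanishes). [folklore] -/
theorem abs_tubeMark_le_shellInd {σ : ℝ} {N : ℕ} (hε : 0 < hsDiameter σ N) (k l : Fin 3) {L κ : ℝ}
    (hL : 0 ≤ L) (hκ : 0 ≤ κ) (z : Config (N + 1) (Fin 3) T3) (i j : Fin (N + 1)) :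
    |tubeMark κ (evenMarkTrunc k l L) ((hsDiameter σ N)⁻¹ • Torus.reprSym ((z i).1 - (z j).1)) (z i).2 (z j).2|
      ≤ 2 * L * shellInd σ N L κ z i j := by
  by_cases h0 : tubeMark κ (evenMarkTrunc k l L) ((hsDiameter σ N)⁻¹ • Torus.reprSym ((z i).1 - (z j).1))
      (z i).2 (z j).2 = 0
  · rw [h0, abs_zero]
    exact mul_nonneg (by linarith) (shellInd_nonneg L κ z i j)
  -- the pair is in the strict tube and the relative speed is `< 2L`
  obtain ⟨h1, h2⟩ := mem_shell_of_tubeMark_ne_zero h0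
  have hmem : (hsDiameter σ N)⁻¹ • Torus.reprSym ((z i).1 - (z j).1) ∈ strictTube κ ((z i).2 - (z j).2) := by
    by_contra hn
    exact h0 (by rw [tubeMark, if_neg hn])
  have hΞne : evenMarkTrunc k l L (impactNormal ((z i).2 - (z j).2)
      ((hsDiameter σ N)⁻¹ • Torus.reprSym ((z i).1 - (z j).1)), (z i).2, (z j).2) ≠ 0 := by
    intro hz
    exact h0 (by rw [tubeMark, if_pos hmem, hz])
  have hspeed : ‖(z j).2 - (z i).2‖ < 2 * L := by
    by_contra hn
    exact hΞne (evenMarkTrunc_eq_zero_of_two_mul_le' k l hL (not_lt.1 hn))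
  have hspeed' : ‖(z i).2 - (z j).2‖ < 2 * L := by rwa [norm_sub_rev]
  -- hence the shell indicator is `1`
  have hn : ‖(hsDiameter σ N)⁻¹ • Torus.reprSym ((z i).1 - (z j).1)‖ = (hsDiameter σ N)⁻¹ * ‖sepAt z i j‖ := by
    rw [norm_smul, Real.norm_eq_abs, abs_of_pos (inv_pos.2 hε)]
    rfl
  rw [hn] at h1 h2
  have hs1 : hsDiameter σ N < ‖sepAt z i j‖ := by
    rwa [lt_inv_mul_iff₀ hε, mul_one] at h1
  have hs2 : ‖sepAt z i j‖ ≤ hsDiameter σ N * (1 + 2 * L * κ) := by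
    have h3 : (hsDiameter σ N)⁻¹ * ‖sepAt z i j‖ ≤ 1 + 2 * L * κ := by
      refine h2.trans ?_
      have := mul_le_mul_of_nonneg_left hspeed'.le hκ
      linarith
    rwa [inv_mul_le_iff₀ hε] at h3
  rw [shellInd, if_pos ⟨hs1, hs2⟩, mul_one]
  exact abs_tubeMark_le (abs_evenMarkTrunc_le k l hL) _ _ _

/-- **At most `125` nonzero tube marks per particle, each of size `≤ 2L`**: on the hard-sphere domain and
for `2Lκ ≤ 1`, `Σⱼ |tubeMark κ Ξ_L (ε⁻¹ sepVec xᵢ xⱼ) vᵢ vⱼ| ≤ 2L · 125` (`shellCount_le`). [folklore] -/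
theorem sum_abs_tubeMark_le {σ : ℝ} {N : ℕ} (hε : 0 < hsDiameter σ N) (k l : Fin 3) {L κ : ℝ}
    (hL : 0 ≤ L) (hκ : 0 ≤ κ) (hLκ : 2 * L * κ ≤ 1) {z : Config (N + 1) (Fin 3) T3}
    (hz : z ∈ hardSphereDomain (Torus.geometry (Fin 3)) (N + 1) (hsDiameter σ N)) (i : Fin (N + 1)) :
    ∑ j, |tubeMark κ (evenMarkTrunc k l L) ((hsDiameter σ N)⁻¹ • Torus.reprSym ((z i).1 - (z j).1))
      (z i).2 (z j).2| ≤ 2 * L * 125 := by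
  calc ∑ j, |tubeMark κ (evenMarkTrunc k l L) ((hsDiameter σ N)⁻¹ • Torus.reprSym ((z i).1 - (z j).1))
        (z i).2 (z j).2|
      ≤ ∑ j, 2 * L * shellInd σ N L κ z i j :=
        Finset.sum_le_sum fun j _ => abs_tubeMark_le_shellInd hε k l hL hκ z i j
    _ = 2 * L * shellCount σ N L κ z i := by rw [shellCount, Finset.mul_sum]
    _ ≤ 2 * L * 125 := mul_le_mul_of_nonneg_left (shellCount_le hε hLκ hz i) (by linarith)

/-! ## The bad event: a large `L²(𝕋³)` deviation of the mollified density -/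

/-- The threshold of `sq_mul_volume_ball_le_integral_sq`: `c(δ, r) = (δ/2)² vol(B_ρ)`,
`ρ = min (δ πr⁴/6) (1/4)`. [folklore] -/
def sqDevThreshold (δ r : ℝ) : ℝ :=
  (δ / 2) ^ 2 * (volume (Metric.ball (0 : EuclideanSpace ℝ (Fin 3)) (min (δ * (Real.pi * r ^ 4) / 6) (1 / 4)))).toReal

/-- The threshold is positive (`δ, r > 0`). [folklore] -/
theorem sqDevThreshold_pos {δ r : ℝ} (hδ : 0 < δ) (hr : 0 < r) : 0 < sqDevThreshold δ r := by
  unfold sqDevThreshold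
  have hρ0 : 0 < min (δ * (Real.pi * r ^ 4) / 6) (1 / 4) := lt_min (by positivity) (by norm_num)
  exact mul_pos (by positivity) (ENNReal.toReal_pos (Metric.measure_ball_pos volume _ hρ0).ne' measure_ball_lt_top.ne)

/-- **The bad event** `Bad_N(δ, r) = {x | c(δ, r) ≤ ∫ (ρ̃_r(x,y) − 1)² dy}` (measurable); off it the
mollified density is within `δ` of `1` at EVERY point. [folklore] -/
def sqDevEvent (n : ℕ) (δ r : ℝ) : Set (Fin n → T3) :=
  {x | sqDevThreshold δ r ≤ ∫ y, (empDensity r x y - 1) ^ 2}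

/-- The integrated square deviation is a measurable function of the positions. [folklore] -/
theorem measurable_integral_sq_empDensity_sub_one (n : ℕ) (r : ℝ) :
    Measurable fun x : Fin n → T3 => ∫ y, (empDensity r x y - 1) ^ 2 := by
  have h := (measurable_sq_empDensity_sub_one (n := n) r).stronglyMeasurable.integral_prod_right'
    (ν := (volume : Measure T3))
  exact h.measurable

/-- The bad event is measurable. [folklore] -/
theorem measurableSet_sqDevEvent (n : ℕ) (δ r : ℝ) : MeasurableSet (sqDevEvent n δ r) :=
  measurableSet_le measurable_const (measurable_integral_sq_empDensity_sub_one n r)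

/-- **Off the bad event the density is uniformly close to `1`**: `|ρ̃_r(x, y) − 1| < δ` for all `y`
(`δ, r > 0`). [folklore] -/
theorem abs_empDensity_sub_one_lt_of_not_mem {n : ℕ} {δ r : ℝ} (hδ : 0 < δ) (hr : 0 < r)
    {x : Fin n → T3} (hx : x ∉ sqDevEvent n δ r) (y : T3) : |empDensity r x y - 1| < δ := by
  by_contra h
  exact hx (sq_mul_volume_ball_le_integral_sq hr hδ x (not_lt.1 h))

/-- **The bad event is improbable at small reduced density**: for every `η > 0` there is `N₀` with
`P_N(Bad_N(δ, r)) ≤ η` for `N ≥ N₀` (Markov and the integrated variance of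
`HardSphereUniformDensityLLN`). [folklore] -/
theorem exists_posGibbs_sqDevEvent_le {σ : ℝ} (h : SmallDensity uniformProfile σ) {a : ℝ} (ha : 0 < a)
    {r : ℝ} (hr : 0 < r) (hr2 : r < 1 / 2) {δ : ℝ} (hδ : 0 < δ) {η : ℝ} (hη : 0 < η) :
    ∃ N₀ : ℕ, ∀ N : ℕ, N₀ ≤ N →
      (posGibbsMeasure (fun _ : T3 => a) (hsDiameter σ N) (N + 1)).real (sqDevEvent (N + 1) δ r) ≤ η := by
  haveI hprob : ∀ N : ℕ, IsProbabilityMeasure (posGibbsMeasure (fun _ : T3 => a) (hsDiameter σ N) (N + 1)) :=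
    fun N => isProbabilityMeasure_posGibbsMeasure continuous_const (fun _ => ha) h.σ_lt_half.le N
  set c := sqDevThreshold δ r with hc
  have hc0 : 0 < c := sqDevThreshold_pos hδ hr
  set M : ℝ := 3 / (Real.pi * r ^ 3) with hM
  have hI0 : ∀ (N : ℕ) (x : Fin (N + 1) → T3), 0 ≤ ∫ y, (empDensity r x y - 1) ^ 2 :=
    fun N x => integral_nonneg fun y => sq_nonneg _
  have hIb : ∀ (N : ℕ) (x : Fin (N + 1) → T3), ∫ y, (empDensity r x y - 1) ^ 2 ≤ (M + 1) ^ 2 := by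
    intro N x
    have hFb : ∀ y : T3, ‖(empDensity r x y - 1) ^ 2‖ ≤ (M + 1) ^ 2 := by
      intro y
      obtain ⟨h0, h1⟩ := empDensity_mem_Icc hr x y
      rw [Real.norm_eq_abs, abs_of_nonneg (sq_nonneg _), ← sq_abs]
      refine pow_le_pow_left₀ (abs_nonneg _) ?_ 2
      rw [abs_le]; constructor <;> linarith
    have h' := norm_integral_le_of_norm_le_const (μ := (volume : Measure T3)) (ae_of_all _ hFb)
    rw [probReal_univ, mul_one, Real.norm_eq_abs] at h'
    exact (le_abs_self _).trans h'
  have hIint : ∀ N : ℕ, Integrable (fun x : Fin (N + 1) → T3 => ∫ y, (empDensity r x y - 1) ^ 2)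
      (posGibbsMeasure (fun _ : T3 => a) (hsDiameter σ N) (N + 1)) :=
    fun N => Integrable.of_bound (measurable_integral_sq_empDensity_sub_one (N + 1) r).aestronglyMeasurable
      ((M + 1) ^ 2) (ae_of_all _ fun x => by rw [Real.norm_eq_abs, abs_of_nonneg (hI0 N x)]; exact hIb N x)
  -- Markov
  have hMarkov : ∀ N : ℕ, (posGibbsMeasure (fun _ : T3 => a) (hsDiameter σ N) (N + 1)).real
      (sqDevEvent (N + 1) δ r) ≤
      (∫ x, (∫ y : T3, (empDensity r x y - 1) ^ 2) ∂posGibbsMeasure (fun _ : T3 => a) (hsDiameter σ N) (N + 1)) / c := by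
    intro N
    have hmk := mul_meas_ge_le_integral_of_nonneg (ae_of_all _ (hI0 N)) (hIint N) c
    rw [le_div_iff₀ hc0, mul_comm]
    exact hmk
  have hW := (tendsto_integral_integral_sq_empDensity_sub_one h ha hr hr2).div_const c
  rw [zero_div] at hW
  obtain ⟨N₀, hN₀⟩ := eventually_atTop.1 (hW (Iio_mem_nhds hη))
  exact ⟨N₀, fun N hN => (hMarkov N).trans (le_of_lt (hN₀ N hN))⟩

/-! ## The density-weight replacement in rung-0 Gibbs mean -/

/-- **Replacing the density weight `g(σ³ρ̃_r(x, xᵢ))` by `g(σ³)` in the tube functional costs little in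
rung-0 Gibbs mean.**  For constant profiles `a, θ > 0`, `u`, `0 < σ ≤ 1/2`, `|χ| ≤ C_χ`, `|g| ≤ C_g` on
`[0, ∞)` with `|g(s y) − g(s)| ≤ ζ'` whenever `y ≥ 0`, `|y − 1| < δ` (`s ≥ 0`), `L, κ ≥ 0`, `2Lκ ≤ 1`,
`r > 0`:
`E_{G_N}[Σ_{i≠j} |χ(xᵢ)| |g(s ρ̃_r(x,xᵢ)) − g(s)| |tubeMark_{ij}|] ≤ 2L · 125 · (N+1) · C_χ · (ζ' + 2C_g P_N(Bad_N(δ, r)))`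
(packing on the hard-sphere domain, which holds almost surely; then the position marginal). [folklore] -/
theorem integral_sum_densityWeight_tubeMark_le {σ a θ : ℝ} {u : V3} {N : ℕ}
    (Φ : HardSphereFlow (Torus.geometry (Fin 3)) (hsDiameter σ N) (N + 1))
    (hσ : 0 < σ) (hσ2 : σ ≤ 1 / 2) (ha : 0 < a) (hθ : 0 < θ)
    {χ : T3 → ℝ} (hχ : Continuous χ) {Cχ : ℝ} (hCχ : ∀ y, |χ y| ≤ Cχ)
    {g : ℝ → ℝ} (hg : Continuous g) {Cg : ℝ} (hCg : ∀ y, 0 ≤ y → |g y| ≤ Cg) {s : ℝ} (hs : 0 ≤ s)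
    {ζ' δ : ℝ} (hζ' : 0 ≤ ζ') (hδ : 0 < δ) (hmod : ∀ y, 0 ≤ y → |y - 1| < δ → |g (s * y) - g s| ≤ ζ')
    (k l : Fin 3) {L κ r : ℝ} (hL : 0 ≤ L) (hκ : 0 ≤ κ) (hLκ : 2 * L * κ ≤ 1) (hr : 0 < r) :
    ∫ z, (∑ i, ∑ j, if i ≠ j then |χ (z i).1| * |g (s * empDensity r (fun m => (z m).1) (z i).1) - g s| *
        |tubeMark κ (evenMarkTrunc k l L) ((hsDiameter σ N)⁻¹ • Torus.reprSym ((z i).1 - (z j).1))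
          (z i).2 (z j).2| else 0) ∂(localGibbsLaw σ (fun _ => a) (fun _ => u) (fun _ => θ) N Φ) ≤
      2 * L * 125 * (N + 1 : ℝ) * Cχ * (ζ' + 2 * Cg *
        (posGibbsMeasure (fun _ : T3 => a) (hsDiameter σ N) (N + 1)).real (sqDevEvent (N + 1) δ r)) := by
  have hε : 0 < hsDiameter σ N := hsDiameter_pos hσ N
  have hCχ0 : 0 ≤ Cχ := (abs_nonneg _).trans (hCχ 0)
  have hCg0 : 0 ≤ Cg := (abs_nonneg _).trans (hCg 0 le_rfl)
  set G := localGibbsLaw σ (fun _ => a) (fun _ => u) (fun _ => θ) N Φ with hGdef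
  set P := posGibbsMeasure (fun _ : T3 => a) (hsDiameter σ N) (N + 1) with hPdef
  haveI hPprob : IsProbabilityMeasure P := isProbabilityMeasure_posGibbsMeasure continuous_const (fun _ => ha) hσ2 N
  haveI hGprob : IsProbabilityMeasure G := isProbabilityMeasure_localGibbsLaw continuous_const continuous_const
    continuous_const (fun _ => ha) (fun _ => hθ) hσ2 N Φ
  -- the deviation weight of particle `i`, a function of the positions
  set D : (Fin (N + 1) → T3) → Fin (N + 1) → ℝ :=
    fun x i => |g (s * empDensity r x (x i)) - g s| with hD
  have hD0 : ∀ x i, 0 ≤ D x i := fun x i => abs_nonneg _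
  have hDb : ∀ x i, D x i ≤ 2 * Cg := fun x i => by
    have hy : 0 ≤ empDensity r x (x i) := (empDensity_mem_Icc hr x (x i)).1
    calc D x i ≤ |g (s * empDensity r x (x i))| + |g s| := abs_sub _ _
      _ ≤ Cg + Cg := add_le_add (hCg _ (mul_nonneg hs hy)) (hCg _ hs)
      _ = 2 * Cg := by ring
  have hDm : ∀ i, Measurable fun x => D x i := fun i => by
    -- compositions are elaborated without expected type (else the unifier unfolds `empDensity`)
    have h0 : Measurable fun x : Fin (N + 1) → T3 => (x, x i) := measurable_id.prodMk (measurable_pi_apply i)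
    have h1 := (measurable_empDensity r).comp h0
    have h2 := ((hg.measurable.comp (h1.const_mul s)).sub (measurable_const (a := g s))).abs
    exact h2
  -- the position weight `W(x) = Σᵢ |χ(xᵢ)| Dᵢ(x)`
  set W : (Fin (N + 1) → T3) → ℝ := fun x => ∑ i, |χ (x i)| * D x i with hW
  have hWm : Measurable W := Finset.measurable_sum _ fun i _ =>
    ((hχ.measurable.comp (measurable_pi_apply i)).abs).mul (hDm i)
  have hW0 : ∀ x, 0 ≤ W x := fun x => Finset.sum_nonneg fun i _ => mul_nonneg (abs_nonneg _) (hD0 x i)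
  have hWb : ∀ x, W x ≤ (N + 1 : ℝ) * (Cχ * (2 * Cg)) := fun x => by
    calc W x ≤ ∑ _i : Fin (N + 1), Cχ * (2 * Cg) :=
          Finset.sum_le_sum fun i _ => mul_le_mul (hCχ _) (hDb x i) (hD0 x i) hCχ0
      _ = (N + 1 : ℝ) * (Cχ * (2 * Cg)) := by
          rw [Finset.sum_const, Finset.card_univ, Fintype.card_fin, nsmul_eq_mul]; push_cast; ring
  -- pointwise bound on the hard-sphere domain
  have hpt : ∀ z ∈ hardSphereDomain (Torus.geometry (Fin 3)) (N + 1) (hsDiameter σ N),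
      (∑ i, ∑ j, if i ≠ j then |χ (z i).1| * |g (s * empDensity r (fun m => (z m).1) (z i).1) - g s| *
        |tubeMark κ (evenMarkTrunc k l L) ((hsDiameter σ N)⁻¹ • Torus.reprSym ((z i).1 - (z j).1))
          (z i).2 (z j).2| else 0) ≤ 2 * L * 125 * W (fun m => (z m).1) := by
    intro z hz
    rw [hW]
    dsimp only
    rw [Finset.mul_sum]
    refine Finset.sum_le_sum fun i _ => ?_
    calc (∑ j, if i ≠ j then |χ (z i).1| * |g (s * empDensity r (fun m => (z m).1) (z i).1) - g s| *
          |tubeMark κ (evenMarkTrunc k l L) ((hsDiameter σ N)⁻¹ • Torus.reprSym ((z i).1 - (z j).1))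
            (z i).2 (z j).2| else 0)
        ≤ ∑ j, |χ (z i).1| * |g (s * empDensity r (fun m => (z m).1) (z i).1) - g s| *
          |tubeMark κ (evenMarkTrunc k l L) ((hsDiameter σ N)⁻¹ • Torus.reprSym ((z i).1 - (z j).1))
            (z i).2 (z j).2| := by
          refine Finset.sum_le_sum fun j _ => ?_
          split_ifs
          · exact le_rfl
          · positivity
      _ = |χ (z i).1| * D (fun m => (z m).1) i *
          ∑ j, |tubeMark κ (evenMarkTrunc k l L) ((hsDiameter σ N)⁻¹ • Torus.reprSym ((z i).1 - (z j).1))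
            (z i).2 (z j).2| := by rw [Finset.mul_sum]
      _ ≤ |χ (z i).1| * D (fun m => (z m).1) i * (2 * L * 125) :=
          mul_le_mul_of_nonneg_left (sum_abs_tubeMark_le hε k l hL hκ hLκ hz i)
            (mul_nonneg (abs_nonneg _) (hD0 _ _))
      _ = 2 * L * 125 * (|χ (z i).1| * D (fun m => (z m).1) i) := by ring
  -- integrate: the hard core holds almost surely, then the position marginal
  have hint_rhs : Integrable (fun z : Config (N + 1) (Fin 3) T3 => 2 * L * 125 * W (fun m => (z m).1)) G := by
    have hm : Measurable fun z : Config (N + 1) (Fin 3) T3 => W (fun m => (z m).1) :=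
      hWm.comp (measurable_pi_lambda _ fun m => (measurable_pi_apply m).fst)
    refine Integrable.of_bound (hm.const_mul _).aestronglyMeasurable (|2 * L * 125| * ((N + 1 : ℝ) * (Cχ * (2 * Cg))))
      (ae_of_all _ fun z => ?_)
    rw [Real.norm_eq_abs, abs_mul, abs_of_nonneg (hW0 _)]
    exact mul_le_mul_of_nonneg_left (hWb _) (abs_nonneg _)
  have hstep1 : ∫ z, (∑ i, ∑ j, if i ≠ j then |χ (z i).1| * |g (s * empDensity r (fun m => (z m).1) (z i).1) - g s| *
        |tubeMark κ (evenMarkTrunc k l L) ((hsDiameter σ N)⁻¹ • Torus.reprSym ((z i).1 - (z j).1))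
          (z i).2 (z j).2| else 0) ∂G ≤ ∫ z, 2 * L * 125 * W (fun m => (z m).1) ∂G := by
    refine integral_mono_of_nonneg (ae_of_all _ fun z => ?_) hint_rhs ?_
    · exact Finset.sum_nonneg fun i _ => Finset.sum_nonneg fun j _ => by
        split_ifs
        · positivity
        · exact le_rfl
    · filter_upwards [ae_mem_hardSphereDomain σ (fun _ => a) (fun _ => u) (fun _ => θ) N Φ] with z hz
      exact hpt z hz
  have hstep2 : ∫ z, 2 * L * 125 * W (fun m => (z m).1) ∂G = 2 * L * 125 * ∫ x, W x ∂P := by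
    rw [integral_const_mul, hGdef, integral_localGibbsLaw_rung0 σ ha.le hθ u N Φ]
    congr 1
    have e : (fun p : (Fin (N + 1) → T3) × (Fin (N + 1) → V3) => W fun m => (zipConfig p m).1) = fun p => W p.1 := by
      funext p
      simp only [zipConfig_apply]
    rw [e, integral_fun_fst, probReal_univ, one_smul]
  -- the position average of `W`
  have hstep3 : ∫ x, W x ∂P ≤ (N + 1 : ℝ) * Cχ * (ζ' + 2 * Cg * P.real (sqDevEvent (N + 1) δ r)) := by
    have hBm : MeasurableSet (sqDevEvent (N + 1) δ r) := measurableSet_sqDevEvent (N + 1) δ r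
    -- `Dᵢ ≤ ζ' + 2 C_g 𝟙[Bad]`
    have hDle : ∀ x i, D x i ≤ ζ' + (sqDevEvent (N + 1) δ r).indicator (fun _ => 2 * Cg) x := by
      intro x i
      by_cases hx : x ∈ sqDevEvent (N + 1) δ r
      · rw [indicator_of_mem hx]
        linarith [hDb x i]
      · rw [indicator_of_notMem hx, add_zero]
        exact hmod _ (empDensity_mem_Icc hr x (x i)).1 (abs_empDensity_sub_one_lt_of_not_mem hδ hr hx (x i))
    have hbound : ∀ x, W x ≤ (N + 1 : ℝ) * Cχ * (ζ' + (sqDevEvent (N + 1) δ r).indicator (fun _ => 2 * Cg) x) := by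
      intro x
      have hind0 : 0 ≤ (sqDevEvent (N + 1) δ r).indicator (fun _ => 2 * Cg) x :=
        Set.indicator_nonneg (fun _ _ => by positivity) x
      calc W x ≤ ∑ _i : Fin (N + 1), Cχ * (ζ' + (sqDevEvent (N + 1) δ r).indicator (fun _ => 2 * Cg) x) :=
            Finset.sum_le_sum fun i _ => mul_le_mul (hCχ _) (hDle x i) (hD0 x i) hCχ0
        _ = (N + 1 : ℝ) * Cχ * (ζ' + (sqDevEvent (N + 1) δ r).indicator (fun _ => 2 * Cg) x) := by
            rw [Finset.sum_const, Finset.card_univ, Fintype.card_fin, nsmul_eq_mul]; push_cast; ring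
    have hint_b : Integrable (fun x => (N + 1 : ℝ) * Cχ * (ζ' + (sqDevEvent (N + 1) δ r).indicator (fun _ => 2 * Cg) x)) P :=
      ((integrable_const ζ').add ((integrable_const (2 * Cg)).indicator hBm)).const_mul _
    calc ∫ x, W x ∂P ≤ ∫ x, (N + 1 : ℝ) * Cχ * (ζ' + (sqDevEvent (N + 1) δ r).indicator (fun _ => 2 * Cg) x) ∂P :=
          integral_mono_of_nonneg (ae_of_all _ hW0) hint_b (ae_of_all _ hbound)
      _ = (N + 1 : ℝ) * Cχ * (ζ' + 2 * Cg * P.real (sqDevEvent (N + 1) δ r)) := by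
          rw [integral_const_mul, integral_add (integrable_const ζ') ((integrable_const (2 * Cg)).indicator hBm),
            integral_const, probReal_univ, one_smul, integral_indicator hBm, setIntegral_const, smul_eq_mul,
            mul_comm (P.real _) (2 * Cg)]
  calc _ ≤ ∫ z, 2 * L * 125 * W (fun m => (z m).1) ∂G := hstep1
    _ = 2 * L * 125 * ∫ x, W x ∂P := hstep2
    _ ≤ 2 * L * 125 * ((N + 1 : ℝ) * Cχ * (ζ' + 2 * Cg * P.real (sqDevEvent (N + 1) δ r))) :=
        mul_le_mul_of_nonneg_left hstep3 (by positivity)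
    _ = 2 * L * 125 * (N + 1 : ℝ) * Cχ * (ζ' + 2 * Cg * P.real (sqDevEvent (N + 1) δ r)) := by ring

end Literature.MathematicalPhysics.KineticTheory

end
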